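import Summits.Ventures.YMGap.FlowData.RectTubeKernelNearIdentity
import Summits.Ventures.YMGap.FlowData.RectTubeFluxNonAnnihilation
import Summits.Ventures.YMGap.FlowData.RectTubeMomentumPiStates
import HarnessLib

/-!
# Venture YMGap, track Y3 FLOW-DATA — every non-trivial flux sector of a finite tube is annihilated at `β = 0`:
# `‖T ∘ P_e‖ ≤ e^{|J| n (#P+N)} − 1` for `e ≠ 0`, hence the torelon energies of a finite `SU(2)` tube DIVERGE as `β → 0⁺`
# (theorems only; corollaries of `RectTubeKernelNearIdentity`)

HONEST FRAMING: venture file of the cell `pub-ymgap` (QuantumFields programme), track Y3.  FINITE rectangular torus only;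
the bound degrades with the volume (`#P + N` = spatial plaquettes + spatial links of one time slice) and is far weaker than
the strong-coupling windows `E ≈ (Ls μ)(−ln u(β)) ± 2β#P` of `RectTubeStrongCouplingWindow`; it says nothing about `L → ∞`,
the continuum, or confinement.  No number of the FLOW-TABLE, no row.  Its only point: a hypothesis-light, elementary
statement that EVERY flux energy of a finite tube tends to `+∞` at strong coupling, in the tree before the window files.

THE ARGUMENT.  `‖Tψ − ⟪1,ψ⟫1‖ ≤ η‖ψ‖` with `η = e^{|J| n (#P+N)} − 1` (`norm_rectTubeTransferOperator_sub_rankOne_le`); the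
constant `1` is twist invariant, so `P_e 1 = 0` for `e ≠ 0` and `⟪1, P_e ψ⟫ = ⟪P_e 1, ψ⟫ = 0`; hence
`‖T P_e ψ‖ ≤ η ‖P_e ψ‖ ≤ η ‖ψ‖`, i.e. `‖T ∘ P_e‖ ≤ η`, and `E_e = ln ‖T‖ − ln ‖T ∘ P_e‖ ≥ ln(2 − e^{…}) − ln η`.

* `rectTubeFluxProjection_const_eq_zero` — `P_e 1 = 0` for `e ≠ 0`;
* **`rectTubeSectorNorm_le_of_ne_zero`** — `‖T ∘ P_e‖ ≤ e^{|J| n (#P+N)} − 1` (`e ≠ 0`, continuous unitary `ρ`, central involution `z`);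
* `rectTubeFluxEnergy_ge_of_small` — `log(2 − e^{|J| n(#P+N)}) − log(e^{|J| n(#P+N)} − 1) ≤ E_e` whenever `0 < ‖T ∘ P_e‖` and the
  bracket is `< 1`;
* **`su2RectTorelonEnergy_ge_of_small`** — the same for the cell's `su2RectTorelonEnergy β Ls μ`, hypothesis-free in `β > 0`
  with `e^{β(#P+N)} < 2`;
* **`su2RectTorelonEnergy_ge_log`** — explicit rate `log β⁻¹ − log(#P+N) − log(5/3) ≤ su2RectTorelonEnergy β Ls μ` once
  `e^{β(#P+N)} ≤ 5/4`;
* **`tendsto_su2RectTorelonEnergy_atTop`** — `su2RectTorelonEnergy β Ls μ → +∞` as `β → 0⁺`;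
* `tendsto_su2RectFluxMomentumPiEnergy_atTop` — the same for the transverse-momentum-`π` energies (`μ ≠ ν`, `Ls ν` even).

References: G. 't Hooft, Nucl. Phys. B 153 (1979) 141 [cite: tHooft1979Flux]; M. Lüscher, Commun. Math. Phys. 54 (1977) 283 [cite: Luscher1977]; I. Montvay, G. Münster (1994) §3.2.6
[cite: MontvayMunster1994, §3.2.6]; T. Kato (1966) Ch. II §1 [folklore].
-/

noncomputable section

open scoped BigOperators ENNReal InnerProductSpace
open MeasureTheory Filter Function Topology
open Literature.MathematicalPhysics.QuantumFieldTheory Literature.Analysis.OperatorTheory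
open Literature.MathematicalPhysics.QuantumLattice (RectTorusSite fundamentalRep continuous_fundamentalRep
  fundamentalRep_mem_unitaryGroup secondCountableTopology_su2)
open Summit.Ventures.LatticeQCDFlow.Exactness

namespace Summit.Ventures.YMGap.FlowData

section Gap

variable {G : Type*} [Group G] [TopologicalSpace G] [IsTopologicalGroup G] [CompactSpace G]
  [MeasurableSpace G] [BorelSpace G] [SecondCountableTopology G] {n : ℕ} (ρ : G →* Matrix (Fin n) (Fin n) ℂ)
  (J : ℝ) {k : ℕ} {Ls : Fin k → ℕ} [∀ i, NeZero (Ls i)]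

omit [SecondCountableTopology G] in
/-- **`P_e 1 = 0` for `e ≠ 0`**: the constant function is twist invariant, so it lies in the trivial-flux sector. [cite: tHooft1979Flux] -/
theorem rectTubeFluxProjection_const_eq_zero (z : G) {e : Fin k → ZMod 2} (he : e ≠ 0) :
    rectTubeFluxProjection z Ls e (Lp.const 2 (rectSliceMeasure G Ls) (1 : ℝ)) = 0 := by
  have hinv : ∀ s : Fin k → ZMod 2,
      rectFluxTwistOp Ls z s (Lp.const 2 (rectSliceMeasure G Ls) (1 : ℝ)) = Lp.const 2 (rectSliceMeasure G Ls) (1 : ℝ) := by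
    intro s
    have h := rectFluxTwistOp_toLp_eq_smul (Ls := Ls) z s (memLp_const (1 : ℝ)) 1 fun b => by simp
    rw [one_smul] at h
    rw [← MemLp.toLp_const]
    exact h
  rw [rectTubeFluxProjection_apply_of_invariant z hinv, if_neg he]

/-- **`‖T ∘ P_e‖ ≤ e^{|J| n (#P+N)} − 1` for every non-trivial flux `e ≠ 0`** (continuous unitary `ρ`, central involution
`z`): `⟪1, P_e ψ⟫ = 0`, so `T P_e ψ = (T − ⟪1,·⟫1)(P_e ψ)`. [folklore] -/
theorem rectTubeSectorNorm_le_of_ne_zero (hρ : Continuous ρ) (hρu : ∀ g, ρ g ∈ Matrix.unitaryGroup (Fin n) ℂ) {z : G}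
    (hzz : z * z = 1) {e : Fin k → ZMod 2} (he : e ≠ 0) :
    rectTubeSectorNorm ρ z J Ls e ≤
      Real.exp (|J| * n * (Fintype.card (RectTorusSite Ls) * Fintype.card {p : Fin k × Fin k // p.1 < p.2} +
        Fintype.card (RectTorusSite Ls × Fin k))) - 1 := by
  set η : ℝ := Real.exp (|J| * n * (Fintype.card (RectTorusSite Ls) * Fintype.card {p : Fin k × Fin k // p.1 < p.2} +
        Fintype.card (RectTorusSite Ls × Fin k))) - 1 with hη
  have hη0 : 0 ≤ η := by
    rw [hη, sub_nonneg]
    exact Real.one_le_exp (by positivity)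
  set one : Lp ℝ 2 (rectSliceMeasure G Ls) := Lp.const 2 (rectSliceMeasure G Ls) (1 : ℝ) with hone
  unfold rectTubeSectorNorm sectorNorm
  rw [show fluxProjection (rectFluxTwistOp Ls z) e = rectTubeFluxProjection z Ls e from rfl]
  refine ContinuousLinearMap.opNorm_le_bound _ hη0 fun ψ => ?_
  rw [ContinuousLinearMap.comp_apply]
  -- `⟪1, P_e ψ⟫ = ⟪P_e 1, ψ⟫ = 0`
  have hsa := isSelfAdjoint_rectTubeFluxProjection (Ls := Ls) z hzz e
  have h0 : @inner ℝ _ _ one (rectTubeFluxProjection z Ls e ψ) = 0 := by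
    have h := (ContinuousLinearMap.isSelfAdjoint_iff_isSymmetric.1 hsa) one ψ
    rw [ContinuousLinearMap.coe_coe, hone, rectTubeFluxProjection_const_eq_zero (Ls := Ls) z he, inner_zero_left] at h
    rw [hone]; exact h.symm
  have h1 := norm_rectTubeTransferOperator_sub_rankOne_le ρ J (Ls := Ls) hρ hρu (rectTubeFluxProjection z Ls e ψ)
  rw [← hone, h0, zero_smul, sub_zero] at h1
  refine h1.trans (mul_le_mul_of_nonneg_left ?_ hη0)
  calc ‖rectTubeFluxProjection z Ls e ψ‖ ≤ ‖rectTubeFluxProjection z Ls e‖ * ‖ψ‖ := ContinuousLinearMap.le_opNorm _ _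
    _ ≤ 1 * ‖ψ‖ := mul_le_mul_of_nonneg_right
        (norm_fluxProjection_le_one (fun s => norm_rectFluxTwistOp_le_one (Ls := Ls) z s) e) (norm_nonneg _)
    _ = ‖ψ‖ := one_mul _

/-- **`log(2 − e^{|J| n(#P+N)}) − log(e^{|J| n(#P+N)} − 1) ≤ E_e`** for `e ≠ 0` whenever the sector is not annihilated and
`e^{|J| n(#P+N)} < 2` (`‖T‖ ≥ 2 − e^{…}`, `‖T ∘ P_e‖ ≤ e^{…} − 1`). [folklore] -/
theorem rectTubeFluxEnergy_ge_of_small (hρ : Continuous ρ) (hρu : ∀ g, ρ g ∈ Matrix.unitaryGroup (Fin n) ℂ) {z : G}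
    (hzz : z * z = 1) {e : Fin k → ZMod 2} (he : e ≠ 0) (hpos : 0 < rectTubeSectorNorm ρ z J Ls e)
    (hsmall : Real.exp (|J| * n * (Fintype.card (RectTorusSite Ls) * Fintype.card {p : Fin k × Fin k // p.1 < p.2} +
        Fintype.card (RectTorusSite Ls × Fin k))) < 2) :
    Real.log (2 - Real.exp (|J| * n * (Fintype.card (RectTorusSite Ls) * Fintype.card {p : Fin k × Fin k // p.1 < p.2} +
        Fintype.card (RectTorusSite Ls × Fin k)))) -
      Real.log (Real.exp (|J| * n * (Fintype.card (RectTorusSite Ls) * Fintype.card {p : Fin k × Fin k // p.1 < p.2} +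
        Fintype.card (RectTorusSite Ls × Fin k))) - 1) ≤ rectTubeFluxEnergy ρ z J Ls e := by
  have hT := two_sub_exp_le_norm_rectTubeTransferOperator ρ J (Ls := Ls) hρ hρu
  have hE := rectTubeSectorNorm_le_of_ne_zero ρ J (Ls := Ls) hρ hρu hzz he
  unfold rectTubeFluxEnergy fluxEnergy
  rw [show sectorNorm (rectTubeTransferOperator ρ J Ls) (rectFluxTwistOp Ls z) e = rectTubeSectorNorm ρ z J Ls e from rfl]
  have h1 := Real.log_le_log (by linarith) hT
  have h2 := Real.log_le_log hpos hE
  linarith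

end Gap

/-! ### `SU(2)`: the torelon energies diverge at strong coupling -/

section SU2

variable {k : ℕ}

/-- **`log(2 − e^{β(#P+N)}) − log(e^{β(#P+N)} − 1) ≤ su2RectTorelonEnergy β Ls μ`** for every `β > 0` with
`e^{β(#P+N)} < 2` (`#P = #sites·k(k−1)/2`, `N = #sites·k`).  Finite volume; the constant degrades with the volume; much
weaker than the strong-coupling window. [folklore] -/
theorem su2RectTorelonEnergy_ge_of_small {β : ℝ} (hβ : 0 < β) (Ls : Fin k → ℕ) [∀ i, NeZero (Ls i)] (μ : Fin k)
    (hsmall : Real.exp (β * (Fintype.card (RectTorusSite Ls) * Fintype.card {p : Fin k × Fin k // p.1 < p.2} +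
        Fintype.card (RectTorusSite Ls × Fin k))) < 2) :
    Real.log (2 - Real.exp (β * (Fintype.card (RectTorusSite Ls) * Fintype.card {p : Fin k × Fin k // p.1 < p.2} +
        Fintype.card (RectTorusSite Ls × Fin k)))) -
      Real.log (Real.exp (β * (Fintype.card (RectTorusSite Ls) * Fintype.card {p : Fin k × Fin k // p.1 < p.2} +
        Fintype.card (RectTorusSite Ls × Fin k))) - 1) ≤ su2RectTorelonEnergy β Ls μ := by
  haveI : SecondCountableTopology (Matrix.specialUnitaryGroup (Fin 2) ℂ) := secondCountableTopology_su2
  set S : ℝ := (Fintype.card (RectTorusSite Ls) : ℝ) * (Fintype.card {p : Fin k × Fin k // p.1 < p.2} : ℝ) +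
        (Fintype.card (RectTorusSite Ls × Fin k) : ℝ) with hS
  have hJ : |β / 2| * ((2 : ℕ) : ℝ) * S = β * S := by
    rw [abs_of_pos (half_pos hβ)]; push_cast; ring
  have hne : (Pi.single μ 1 : Fin k → ZMod 2) ≠ 0 := by
    intro h
    have := congr_fun h μ
    rw [Pi.single_eq_same, Pi.zero_apply] at this
    exact one_ne_zero this
  have hpos : 0 < rectTubeSectorNorm (fundamentalRep (Fin 2)) su2MinusOne (β / 2) Ls (Pi.single μ 1) :=
    su2_rectTubeSectorNorm_single_pos hβ.ne' Ls μ
  have h := rectTubeFluxEnergy_ge_of_small (fundamentalRep (Fin 2)) (β / 2) (Ls := Ls) (continuous_fundamentalRep (Fin 2))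
    fundamentalRep_mem_unitaryGroup su2MinusOne_mul_self hne hpos (by rw [hJ]; exact hsmall)
  rw [hJ] at h
  exact h

/-- **Explicit rate: `su2RectTorelonEnergy β Ls μ ≥ log β⁻¹ − log(#P+N) − log(5/3)`** for every `β > 0` with
`e^{β(#P+N)} ≤ 5/4` (`‖T‖ ≥ 3/4`, `‖T ∘ P_e‖ ≤ (5/4)β(#P+N)`).  Finite volume only. [folklore] -/
theorem su2RectTorelonEnergy_ge_log {β : ℝ} (hβ : 0 < β) (Ls : Fin k → ℕ) [∀ i, NeZero (Ls i)] (μ : Fin k)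
    (h54 : Real.exp (β * (Fintype.card (RectTorusSite Ls) * Fintype.card {p : Fin k × Fin k // p.1 < p.2} +
        Fintype.card (RectTorusSite Ls × Fin k))) ≤ 5 / 4) :
    -Real.log β - Real.log ((Fintype.card (RectTorusSite Ls) : ℝ) * Fintype.card {p : Fin k × Fin k // p.1 < p.2} +
        Fintype.card (RectTorusSite Ls × Fin k)) - Real.log (5 / 3) ≤ su2RectTorelonEnergy β Ls μ := by
  set S : ℝ := (Fintype.card (RectTorusSite Ls) : ℝ) * (Fintype.card {p : Fin k × Fin k // p.1 < p.2} : ℝ) +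
        (Fintype.card (RectTorusSite Ls × Fin k) : ℝ) with hS
  have hSpos : 0 < S := by
    have hN : 0 < (Fintype.card (RectTorusSite Ls × Fin k) : ℝ) := by
      have : 0 < Fintype.card (RectTorusSite Ls × Fin k) := Fintype.card_pos_iff.2 ⟨(0, μ)⟩
      exact_mod_cast this
    have : (0 : ℝ) ≤ (Fintype.card (RectTorusSite Ls) : ℝ) * (Fintype.card {p : Fin k × Fin k // p.1 < p.2} : ℝ) := by
      positivity
    rw [hS]; linarith
  have hx0 : 0 ≤ β * S := (mul_pos hβ hSpos).le
  have hη : Real.exp (β * S) - 1 ≤ 5 / 4 * (β * S) := exp_sub_one_le_mul_of_exp_le hx0 h54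
  have hηpos : 0 < Real.exp (β * S) - 1 := sub_pos.2 (Real.one_lt_exp_iff.2 (mul_pos hβ hSpos))
  have h1 := su2RectTorelonEnergy_ge_of_small hβ Ls μ (by linarith : Real.exp (β * S) < 2)
  have h2 : Real.log (Real.exp (β * S) - 1) ≤ Real.log (5 / 4 * (β * S)) := Real.log_le_log hηpos hη
  rw [Real.log_mul (by norm_num) (mul_pos hβ hSpos).ne', Real.log_mul hβ.ne' hSpos.ne'] at h2
  have h3 : Real.log (3 / 4) ≤ Real.log (2 - Real.exp (β * S)) := Real.log_le_log (by norm_num) (by linarith)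
  have h4 : Real.log (5 / 3) = Real.log (5 / 4) - Real.log (3 / 4) := by
    rw [← Real.log_div (by norm_num) (by norm_num)]; norm_num
  rw [h4]
  linarith

/-- **The torelon energies of a finite `SU(2)` tube diverge at strong coupling: `su2RectTorelonEnergy β Ls μ → +∞` as
`β → 0⁺`** (every rectangular tube, every axis `μ`).  Finite volume only. [folklore] -/
theorem tendsto_su2RectTorelonEnergy_atTop (Ls : Fin k → ℕ) [∀ i, NeZero (Ls i)] (μ : Fin k) :
    Tendsto (fun β => su2RectTorelonEnergy β Ls μ) (𝓝[>] 0) atTop := by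
  set S : ℝ := (Fintype.card (RectTorusSite Ls) : ℝ) * (Fintype.card {p : Fin k × Fin k // p.1 < p.2} : ℝ) +
        (Fintype.card (RectTorusSite Ls × Fin k) : ℝ) with hS
  have hSpos : 0 < S := by
    have hN : 0 < (Fintype.card (RectTorusSite Ls × Fin k) : ℝ) := by
      have : 0 < Fintype.card (RectTorusSite Ls × Fin k) := Fintype.card_pos_iff.2 ⟨(0, μ)⟩
      exact_mod_cast this
    have : (0 : ℝ) ≤ (Fintype.card (RectTorusSite Ls) : ℝ) * (Fintype.card {p : Fin k × Fin k // p.1 < p.2} : ℝ) := by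
      positivity
    rw [hS]; linarith
  -- `e^{βS} → 1`: `η(β) = e^{βS} − 1 → 0⁺` and `2 − e^{βS} → 1`
  have hexp : Tendsto (fun β : ℝ => Real.exp (β * S)) (𝓝 0) (𝓝 1) := by
    have : Continuous fun β : ℝ => Real.exp (β * S) := by continuity
    have h := this.tendsto 0
    rwa [zero_mul, Real.exp_zero] at h
  have hη : Tendsto (fun β : ℝ => Real.exp (β * S) - 1) (𝓝[>] 0) (𝓝[>] 0) := by
    have h1 : Tendsto (fun β : ℝ => Real.exp (β * S) - 1) (𝓝 0) (𝓝 0) := by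
      have h := hexp.sub_const 1
      rwa [sub_self] at h
    refine tendsto_nhdsWithin_iff.2 ⟨h1.mono_left nhdsWithin_le_nhds, ?_⟩
    filter_upwards [self_mem_nhdsWithin] with β (hβ : 0 < β)
    exact sub_pos.2 (Real.one_lt_exp_iff.2 (mul_pos hβ hSpos))
  have hlog1 : Tendsto (fun β : ℝ => Real.log (2 - Real.exp (β * S))) (𝓝[>] 0) (𝓝 0) := by
    have h2 : Tendsto (fun β : ℝ => 2 - Real.exp (β * S)) (𝓝 0) (𝓝 1) := by
      have h := hexp.const_sub 2
      norm_num at h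
      exact h
    have h3 := (Real.continuousAt_log one_ne_zero).tendsto.comp h2
    rw [Real.log_one] at h3
    exact h3.mono_left nhdsWithin_le_nhds
  have hlog2 : Tendsto (fun β : ℝ => -Real.log (Real.exp (β * S) - 1)) (𝓝[>] 0) atTop :=
    tendsto_neg_atBot_atTop.comp (Real.tendsto_log_nhdsGT_zero.comp hη)
  have hsum : Tendsto (fun β : ℝ => Real.log (2 - Real.exp (β * S)) - Real.log (Real.exp (β * S) - 1)) (𝓝[>] 0) atTop := by
    have h := Filter.Tendsto.add_atTop hlog1 hlog2
    simpa only [sub_eq_add_neg] using h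
  have hev : ∀ᶠ β in 𝓝[>] (0 : ℝ), Real.exp (β * S) < 2 :=
    (hexp.mono_left nhdsWithin_le_nhds).eventually (eventually_lt_nhds (by norm_num : (1 : ℝ) < 2))
  refine tendsto_atTop_mono' _ ?_ hsum
  filter_upwards [hev, self_mem_nhdsWithin] with β hβ2 (hβ : 0 < β)
  exact su2RectTorelonEnergy_ge_of_small hβ Ls μ hβ2

/-- **The transverse-momentum-`π` energies diverge too: `su2RectFluxMomentumPiEnergy β Ls ê_μ ν → +∞` as `β → 0⁺`**
(`μ ≠ ν`, `Ls ν` even), since `E_μ ≤ E^π_{μ,ν}` (`RectTubeMomentumPiStates`).  Finite volume only. [cite: Luscher1977] -/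
theorem tendsto_su2RectFluxMomentumPiEnergy_atTop (Ls : Fin k → ℕ) [∀ i, NeZero (Ls i)] {μ ν : Fin k} (hμν : μ ≠ ν)
    (hν : Even (Ls ν)) :
    Tendsto (fun β => su2RectFluxMomentumPiEnergy β Ls (Pi.single μ 1) ν) (𝓝[>] 0) atTop := by
  refine tendsto_atTop_mono' _ ?_ (tendsto_su2RectTorelonEnergy_atTop Ls μ)
  filter_upwards [self_mem_nhdsWithin] with β (hβ : 0 < β)
  exact su2RectTorelonEnergy_le_fluxMomentumPiEnergy hβ.ne' Ls hμν hν

end SU2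

end Summit.Ventures.YMGap.FlowData
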